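import Literature.MathematicalPhysics.QuantumFieldTheory.Balaban1983to89.B9SupplySockB9P3ZdBeta
import Literature.MathematicalPhysics.QuantumFieldTheory.Balaban1983to89.B8Ineq159FlatCubeMemberPrinted

/-!
# `Balaban1983to89.B9SupplySockB9P3ZdGamma` — [Balaban1985RegularSpaces] (1.56)–(1.59) p. 86, (1.31) p. 82, p. 77 ∕ [Balaban1984PropagatorsII] (2.3)
# p. 224 ∕ [Balaban1985BackgroundPropagators] (3.16) p. 393, Thm 3.3 p. 399: EDITION γ OF THE J-N06→N05 JUNCTION — THE AVERAGING DATUM CLASS AS AN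
# EXPLICIT PARAMETER of the binder (`AvgAtγ`) and of the member supplier (`sockB9P3D4γ_at`), decoupled from the member's law field `ZdIdx.Λb`, under ONE
# locality law of the class relative to `Ω₀` (`SeesDom`); its family forms; the instantiation of the law at print's class `cubeLamBP` of the cube member;
# and an A6 SATISFIABILITY WITNESS of the member supplier's hypothesis set at (cube member, truncation 0) for every admissible class

statement-level skeleton of published theorems with citation tags; proofs where landed; nothing here is a claim about the
Yang–Mills mass gap

`[Balaban1985RegularSpaces]` ("B8", CMP **99** (1985) 75–102) (1.31) p. 82, (1.56)–(1.59) p. 86, Prop. 3 p. 87, Thm 4 p. 88, (1.131) p. 99, p. 77 (bond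
convention); `[Balaban1984PropagatorsII]` ("B6", CMP **96** (1984) 223–250) (2.3) p. 224 («Λ_j = Ω_j^{(j)} ∖ Ω_{j+1}^{(j)} … for the sets of sites and the sets
of bonds»; a bond of `Ω` = «at least one end-point of b belongs to Ω»); [4] = `[Balaban1985BackgroundPropagators]` (CMP **99** (1985) 389–434) (3.16) p. 393,
(3.26)–(3.27) p. 395, Thm 3.3 p. 399, (3.47) p. 398, (3.69) p. 404.  PDF held: `paper:balaban1985-cmp99-background-propagators`,
`paper:balaban1985-cmp99-regular-spaces-gauge-fixing`, `paper:balaban1984-cmp96-propagators-rt-ii`.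

WHY THIS FILE (cell `pub-ymgap`, seat `pub-ymgap-dag-n06-b` g16, dag-lead DEDUP-345 (7) «socket edition γ = n06-b's pen»; count-neutral).  dag-n05-c g11's
LOCATED-1 + certificates (`B8Ineq159FlatShellModeVacuity` p572834 at the cube member; `B8SockB9P3ShellModeVacuityUniv.not_sB9all_idxB8SubB` p576185 at the
lawful `Ω₀ = ℤᵈ` members) show that every (1.59)-type socket whose averaging datum `|B₁|` is read over a class obeying the `ZdIdx` bond laws `hbox`∕`hclass`
(`B8CubeMemberZd.cubeLamB`, `B8IdxB8LawsB.towerBonds` — both WITHOUT print's level-`j ≥ 1` CROSSING bonds, `towerBonds_inner_of_printTower`) is FALSE at truncation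
`m ≥ 1` at every member with a genuine shell `□_j`, by an interior pure-gauge shell mode `∂λ`, `λ ⊂ □_j` — the level-`j ≥ 1` twin of this lineage's level-`0`
crossing-bond finding (`B9SupplySockB9P3ZdAtBoundaryMode` ∕ `…SocketBoundaryMode`, repaired at level `0` by EDITION β `B9SupplySockB9P3ZdBeta`).  The socket
itself (`SockB9P3D4β L B₀ B_∂ cP η k Ω Λs Λb`) already takes the datum class `Λb` as an explicit argument; what tied the junction to the defective law was
the BINDER `AvgAtβ … M i m` (and `AvgAt`), which reads the class from the member's law field `i.Λb`, and the member supplier, which used `ZdIdx.hbox` once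
(`wsupB1β_restrictDom`: the datum of `𝟙_{Ω₀}A` equals that of `A`).  EDITION γ therefore makes the class an explicit PARAMETER `ΛbP` of the binder and of the
supplier, under the one law the supplier needs (`SeesDom`: every datum bond is read inside `Ω₀`), so that consumers can plug PRINT's class — [B6] (2.3) ∕
(1.31): inner AND crossing bonds; at the cube member dag-n05-c's `B8Ineq159FlatCubeMemberPrinted.cubeLamBP` (p573921), whose law is §4 here from
`cubeLamBP_box_subset_pred` ∕ `cubeLamBP_zero_bondTouches` (p575549) — WITHOUT waiting for the re-typing of `ZdIdx.hbox` ∕ law №12 (n05-a's pen), and so that the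
old editions are instances (`ΛbP := i.Λb`, `avgAtγ_self`, `seesDom_self`).  Consumers: dag-n05-e's cube-road junction chain (token swap `cubeLamB ↦ cubeLamBP` in the
socket's class slot, `AvgAtβ ↦ AvgAtγ … (cubeLamBP …)`, supplier `sockB9P3D4γ_allLevels_of_thm33_on` with `hsee := seesDom_cubeLamBP`); the univ-road (`SockB9P3`,
sourced ∕ `_lin` forms) γ edition is the companion file `B9SupplySockB9P3ZdGammaUniv`.

WHAT IS PROVED (kernel, 0 sorry; 3 definitions + theorems; no `instance`, no `notation`).
* §1 `SeesDom L m Ω₀ ΛbP` — the locality law of a datum class relative to `Ω₀`: every bond of `ΛbP m j`, `j ≤ m`, has its level-`j` box `Bʲ(c₋) ∪ Bʲ(c₊)` in `Ω₀`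
  OR is a level-`0` bond touching `Ω₀` (so `Q_j(U₀)A` at it reads `A` on `Ω₀`-bonds only); `seesDom_of_hbox` (the old law ⇒ `SeesDom`), `seesDom_self` (a
  `ZdIdx` member's own `Λb`), `seesDom_univ` (trivial at `Ω₀ = ℤᵈ`), `seesDom_zero_of_touch`.
* §2 ★ `AvgAtγ L ops q ΛbP M i m` — `B9SupplySockB9P3ZdBeta.AvgAtβ` VERBATIM with `i.Λb m j ↦ ΛbP m j` ((3.16) with (1.56)∕(1.58): «(Lʲη)³|(Q*aQA)(b)| ≤ q·|B₁|(A)»,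
  `|B₁|` over `ΛbP` and the level-0 crossing bonds of `Ω₀`); `avgAtγ_self` (`ΛbP := i.Λb` is `AvgAtβ`, `Iff.rfl`); `wsupB1γ_restrictDom` (`|B₁|(𝟙_{Ω₀}A) = |B₁|(A)`
  under `SeesDom`).
* §3 ★★ `sockB9P3D4γ_at` — [4] Thm 3.3's `G(U₀)`-block at one member with `Margin2` + the dictionary `DictAt` + `Prop6At InvAt CurvAt LandauAt` + `AvgAtγ … ΛbP` +
  `SeesDom L m (i.Ω 0) ΛbP` ⟹ `SockB9P3D4β L B₀′ B_∂ cP i.η m i.Ω i.Λs ΛbP` — the β member supplier's proof VERBATIM (two tokens changed), SAME constants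
  `B₀′ = max{1, 2B₀max{1,q}}`, `B_∂ = (20d+2)B₀′`, `cP = min{1∕16, c₆∕M, a₀∕(K₆M), a₃∕(K₆M), 1∕(2B₀c₆₉K₆M+1)}`; ★ `sockB9P3D4γ_allLevels_of_thm33_on` ∕
  ★ `sockB9P3D4γ_allLevels_explicit_on` — the two family forms over an index map `ι : J → ZdIdx d L` with a member-wise class `ΛbP : J → ℕ → ℕ → Set _`.
* §4 the law at print's class of the cube member (dag-n05-c's lemmas BY NAME): `seesDom_cubeLamBP` (`L ≤ ρ`, `m ≤ k`), `mem_cubeLamBP_zero_of_bondTouches`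
  (at truncation `0` every `□₀`-bond is in the class); and dag-n05-e's SPLIT class `cubeLamBP'` (level `0` = the inner class `cubeLamB … m 0`, levels `j ≥ 1` =
  `cubeLamBP`; the level-0 crossing bonds ride in the socket's own disjunct): `cubeLamBP'_zero`, `cubeLamBP'_of_ne_zero`, `seesDom_cubeLamBP'`,
  `mem_cubeLamBP'_zero_of_inner`, `cubeLamBP'_zero_bondTouches`.
* §5 A6 (director-ym №189 (3)): ★★ `Witness.binders_inhabited_cube_zero_γ` — at every cube member of (1.131), truncation `m = 0`, and EVERY class `ΛbP` with
  «inner `□₀`-bonds ⊆ `ΛbP 0 0` ⊆ `□₀`-bonds», the hypothesis set of `sockB9P3D4γ_at` is INHABITED (edition β's witness `opsW ∕ geoW ∕ bgW ∕ GAW` — trivial massive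
  regime — by import; no hypothesis on `i.Λb`); ★ `Witness.sockB9P3D4γ_at_nonvacuous_cube_zero`; at print's class: ★ `Witness.binders_inhabited_cubeLamBP_zero`,
  ★ `Witness.sockB9P3D4γ_at_nonvacuous_cubeLamBP_zero`, ★ `Witness.sockB9P3D4γ_at_nonvacuous_cubeLamBP'_zero`.

HONEST SCOPE.  (i) Re-typing of this lineage's own binder ∕ supplier with the class as a parameter, kernel bookkeeping, and an A6 witness at `m = 0`; NO
estimate of [4] ∕ [B8] is proved; every analytic input stays a displayed hypothesis of printed shape ([4] Thm 3.3's block `h33U`, the dictionary, the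
letters).  (ii) The `m ≥ 1` inhabitation of the binders at print's class is N06's object layer ([4] Sect. A + Thm 3.11 + Thm 3.3) — NOT witnessed; whether
print's class kills every shell mode at `m ≥ 1` is dag-n05-c's `B8Ineq159FlatShellModeCrossingDatum` (the repair bites), not this file.  (iii) `wsup` carries
r05's junk value `0` on unbounded families, so the socket is not provably monotone in the class in general — the γ supplier is RE-DERIVED, not transported
from β.  (iv) Count-neutral; N05 ∕ N06 NOT discharged; one finite lattice programme; nothing continuum ∕ ℝ⁴ ∕ OS ∕ mass-gap ∕ Clay.  Unit
`pub-ymgap-dag-n06-b` (g16), 2026-08-27.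
-/

noncomputable section

open NormedSpace

namespace Literature.MathematicalPhysics.QuantumFieldTheory.Balaban1983to89.B9SupplySockB9P3ZdGamma

open B7Prop1Explicit (e U1)
open B7Prop1Local (InBox loK bondHiK)
open B7Prop2Explicit (unitaryUnits unitaryUnits_le_U1)
open B7Prop4GeneralLevels (linCovIter)
open B7Eq78Linearization (conjR)
open B8Ineq132 (covDerivFwd covDeriv InAk BondTouches)
open B8Eq140Level (SideTouches)
open B8Eq146AExpansion (iEta plaqCovDeriv)
open B8Eq143PlaqExpansion (pdiv)
open B8Eq155JBound (Jcur wsup)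
open B8ScaledSupNorm (bondNorm msup weight Bdd)
open B8Eq138LandauZd (IsLandau138 IsLandau138W QT covDivB logCfg covLap)
open B8Eq184Proof (cfgExp)
open B8Lemma1NonAbelian (mulCfg)
open B8LeafModelZd (ZdIdx)
open B9SupplySockB9P3ZdLetters (OpsZd deltaAOf)
open B9SupplySockB9P3ZdLettersOmega (OnDom restrictDom outerPart Margin2 restrictDom_of)
open B9SupplySockB9P3ZdOmega (collar_arith)
open B9SupplySockB9P3ZdAt (DictAt Prop6At InvAt CurvAt LandauAt)
open B9SupplySockB9P3ZdBeta (CrossB SockB9P3D4β AvgAtβ)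
open B8Eq131CubesAdmissible (cubeFam cubeFam_false_zero)
open B8Eq131Cubes (cube sqLo sqHi cube_anti)
open B8CubeMemberZd (cubeLamB)
open B8Ineq159FlatCubeMemberPrinted (cubeLamBP cubeLamBP_box_subset_pred cubeLamBP_zero_bondTouches)

export B7Prop1Explicit (Site)

variable {d : ℕ}

/-! ## §1 The locality law of a datum class relative to `Ω₀` -/

/-- **`SeesDom L m Ω₀ ΛbP` — EVERY DATUM BOND OF THE CLASS IS READ INSIDE `Ω₀`**: for `j ≤ m` and `c ∈ ΛbP m j`, either the level-`j` box `Bʲ(c₋) ∪ Bʲ(c₊)` of `c`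
(the sites `Q_j(U₀)(·)(c)` reads, (1.56)) lies in `Ω₀`, or `j = 0` and `c` is a bond of `Ω₀` (p. 77: an end-point in `Ω₀`; `Q₀ = 1` reads `c` itself).  The old
bond law «box ⊂ Ω_j ⊂ Ω₀» implies it; print's class (inner bonds: box ⊂ Ω_j; crossing bonds: box ⊂ Ω_{j−1}; level 0: bonds of Ω₀) obeys it.
[cite: Balaban1985RegularSpaces, (1.56) p.86, (1.31) p.82, p.77; Balaban1984PropagatorsII, (2.3) p.224] -/
def SeesDom (L m : ℕ) (Ω₀ : Set (Site d)) (ΛbP : ℕ → ℕ → Set (Site d × Fin d)) : Prop :=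
  ∀ j, j ≤ m → ∀ c ∈ ΛbP m j, (∀ x, InBox (loK L j c.1) (bondHiK L j c.1 c.2) x → x ∈ Ω₀) ∨ (j = 0 ∧ BondTouches Ω₀ c.1 c.2)

/-- The old bond law «the box of every constraint bond lies in `Ω₀`» implies `SeesDom`. [cite: Balaban1985RegularSpaces, (1.31) p.82, p.77] -/
theorem seesDom_of_hbox {L m : ℕ} {Ω₀ : Set (Site d)} {Λb : ℕ → ℕ → Set (Site d × Fin d)}
    (hbox : ∀ j, j ≤ m → ∀ c ∈ Λb m j, ∀ x, InBox (loK L j c.1) (bondHiK L j c.1 c.2) x → x ∈ Ω₀) : SeesDom L m Ω₀ Λb :=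
  fun j hj c hc => Or.inl (hbox j hj c hc)

/-- A `ZdIdx` member's own law class `i.Λb` obeys `SeesDom` relative to `i.Ω 0` at every truncation `m ≤ k` (`ZdIdx.hbox` + the nesting of the `Ω_j`). [cite: Balaban1985RegularSpaces, (1.31) p.82, (1.5) p.77] -/
theorem seesDom_self {L : ℕ} (i : ZdIdx d L) {m : ℕ} (hm : m ≤ i.k) : SeesDom L m (i.Ω 0) i.Λb :=
  seesDom_of_hbox (B9SupplySockB9P3ZdLettersOmega.hbox_zero i hm)

/-- At `Ω₀ = ℤᵈ` every class obeys `SeesDom`. [cite: Balaban1985RegularSpaces, p.77 («Ω_j = T_η»)] -/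
theorem seesDom_univ (L m : ℕ) (ΛbP : ℕ → ℕ → Set (Site d × Fin d)) : SeesDom L m (Set.univ : Set (Site d)) ΛbP :=
  fun _ _ _ _ => Or.inl fun _ _ => Set.mem_univ _

/-- At truncation `0` a class of `Ω₀`-bonds obeys `SeesDom`. [cite: Balaban1985RegularSpaces, p.77, (1.58) p.86] -/
theorem seesDom_zero_of_touch {L : ℕ} {Ω₀ : Set (Site d)} {ΛbP : ℕ → ℕ → Set (Site d × Fin d)}
    (h : ∀ b ∈ ΛbP 0 0, BondTouches Ω₀ b.1 b.2) : SeesDom L 0 Ω₀ ΛbP := by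
  intro j hj c hc
  obtain rfl : j = 0 := Nat.le_zero.mp hj
  exact Or.inr ⟨rfl, h c hc⟩

variable {𝔸 : Type*} [CStarAlgebra 𝔸]

/-! ## §2 The averaging binder at a supplied datum class, and the restriction lemma -/

section Binder

variable (L : ℕ)

/-- ★ **THE AVERAGING TERM IS BOUNDED BY `|B₁|` READ OVER A SUPPLIED DATUM CLASS `ΛbP`, AT ONE MEMBER** — `B9SupplySockB9P3ZdBeta.AvgAtβ` VERBATIM with the class
`ΛbP m j` in place of the member's law field `i.Λb m j` (the level-0 crossing bonds of `Ω₀` kept): (3.16) «⟨A, Q*aQA⟩ = Σ_j a Σ_{b∈Λ_j} (Lʲη)^{d−2}|(Q_j(U)A)(b)|²» read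
with (1.56)∕(1.58) as «(Lʲη)³|(Q*aQA)(b)| ≤ q·|B₁|(A)», the datum `|B₁|` running over print's constraint bonds — whichever class the consumer's edition carries.
[cite: Balaban1985BackgroundPropagators, (3.16) p.393; Balaban1985RegularSpaces, (1.56), (1.58) p.86, (1.31) p.82, p.77; Balaban1984PropagatorsII, (2.3) p.224] -/
def AvgAtγ (ops : ℝ → ZdIdx d L → ℕ → OpsZd d 𝔸) (q : ℝ) (ΛbP : ℕ → ℕ → Set (Site d × Fin d)) (M : ℝ) (i : ZdIdx d L) (m : ℕ) : Prop :=
  ∀ (U₀ : Site d → Fin d → 𝔸ˣ), (∀ x κ, U₀ x κ ∈ unitaryUnits 𝔸) →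
    ∀ A : Site d → Fin d → 𝔸, OnDom L m i.η i.Ω A → ∀ j, j ≤ m → ∀ (x : Site d) (μ : Fin d), BondTouches (i.Ω j) x μ →
      ((L : ℝ) ^ j * i.η) ^ 3 * ‖(ops M i m).QQ U₀ A x μ‖ ≤
        q * wsup 1 (fun p : {p : ℕ × (Site d × Fin d) // p.1 ≤ m ∧ (p.2 ∈ ΛbP m p.1 ∨ (p.1 = 0 ∧ CrossB (i.Ω 0) p.2))} =>
              linCovIter L U₀ (iEta i.η A) p.1.1 p.1.2.1 p.1.2.2)

/-- At the member's own law class, `AvgAtγ` IS edition β's `AvgAtβ` (definitional). [cite: Balaban1985BackgroundPropagators, (3.16) p.393; Balaban1985RegularSpaces, (1.56) p.86] -/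
theorem avgAtγ_self (ops : ℝ → ZdIdx d L → ℕ → OpsZd d 𝔸) (q M : ℝ) (i : ZdIdx d L) (m : ℕ) :
    AvgAtγ L ops q i.Λb M i m ↔ AvgAtβ L ops q M i m := Iff.rfl

variable {L}

/-- **`|B₁|` over a class obeying `SeesDom` does not see the outer part**: `|B₁|(𝟙_{Ω₀}A) = |B₁|(A)` — `B9SupplySockB9P3ZdBeta.wsupB1β_restrictDom` with the
box law replaced by `SeesDom` (box in `Ω₀` ⇒ locality of `Q_j`, `B9Ineq3137LocalSup.linCovIter_congr`; a level-0 bond of `Ω₀` ⇒ `Q₀ = 1` reads the bond itself).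
[cite: Balaban1985RegularSpaces, (1.56) p.86, p.77; Balaban1985Averaging, p.24 (after (43))] -/
theorem wsupB1γ_restrictDom (hL : 1 ≤ L) (m : ℕ) (η : ℝ) {Ω : ℕ → Set (Site d)} {Λb : ℕ → ℕ → Set (Site d × Fin d)}
    (hsee : SeesDom L m (Ω 0) Λb) (U₀ : Site d → Fin d → 𝔸ˣ) (A : Site d → Fin d → 𝔸) :
    wsup 1 (fun p : {p : ℕ × (Site d × Fin d) // p.1 ≤ m ∧ (p.2 ∈ Λb m p.1 ∨ (p.1 = 0 ∧ CrossB (Ω 0) p.2))} =>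
        linCovIter L U₀ (iEta η (restrictDom (Ω 0) A)) p.1.1 p.1.2.1 p.1.2.2) =
      wsup 1 (fun p : {p : ℕ × (Site d × Fin d) // p.1 ≤ m ∧ (p.2 ∈ Λb m p.1 ∨ (p.1 = 0 ∧ CrossB (Ω 0) p.2))} =>
        linCovIter L U₀ (iEta η A) p.1.1 p.1.2.1 p.1.2.2) := by
  have h : (fun p : {p : ℕ × (Site d × Fin d) // p.1 ≤ m ∧ (p.2 ∈ Λb m p.1 ∨ (p.1 = 0 ∧ CrossB (Ω 0) p.2))} =>
        linCovIter L U₀ (iEta η (restrictDom (Ω 0) A)) p.1.1 p.1.2.1 p.1.2.2) =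
      fun p : {p : ℕ × (Site d × Fin d) // p.1 ≤ m ∧ (p.2 ∈ Λb m p.1 ∨ (p.1 = 0 ∧ CrossB (Ω 0) p.2))} =>
        linCovIter L U₀ (iEta η A) p.1.1 p.1.2.1 p.1.2.2 := by
    funext p
    obtain ⟨⟨j, b⟩, hj, hjb⟩ := p
    dsimp only
    have key : (∀ x, InBox (loK L j b.1) (bondHiK L j b.1 b.2) x → x ∈ Ω 0) ∨ (j = 0 ∧ BondTouches (Ω 0) b.1 b.2) := by
      rcases hjb with hc | ⟨h0, hx⟩
      · exact hsee j hj b hc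
      · exact Or.inr ⟨h0, hx.1⟩
    rcases key with hbox | ⟨h0, hbt⟩
    · refine B9Ineq3137LocalSup.linCovIter_congr L hL j b.1 b.2 (fun _ _ _ _ => rfl) fun x κ hx _ => ?_
      have hxΩ : x ∈ Ω 0 := hbox x hx
      simp only [iEta, restrictDom_of A (Or.inl hxΩ : BondTouches (Ω 0) x κ)]
    · subst h0
      simp only [B7Prop4GeneralLevels.linCovIter_zero, iEta, restrictDom_of A hbt]
  rw [h]

end Binder

/-! ## §3 The member supplier at a supplied datum class ([4] Theorem 3.3 ⇒ the four-line collar socket at `ΛbP`) and its family forms -/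

section Supply

variable [Nontrivial 𝔸]
variable {I : Type} (geo : I → B9.Geometry) (bg : I → B9.Backgrounds) (GA : ∀ i, B9.KernelFamily (geo i) (bg i))
variable (L : ℕ) (mem : ℝ → ZdIdx d L → ℕ → I)
variable (ιCfg : ∀ (M : ℝ) (i : ZdIdx d L) (m : ℕ) (U₀ : Site d → Fin d → 𝔸ˣ),
  (∀ x κ, U₀ x κ ∈ unitaryUnits 𝔸) → (bg (mem M i m)).Cfg)
variable (ιLoc : ∀ (M : ℝ) (i : ZdIdx d L) (m : ℕ), (Site d → Fin d → 𝔸) → (geo (mem M i m)).Loc)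
variable (ops : ℝ → ZdIdx d L → ℕ → OpsZd d 𝔸)

set_option maxHeartbeats 400000 in
/-- ★★ **THEOREM 3.3 FOR G(U₀) AT ONE MEMBER WITH `Margin2` SUPPLIES THE β COLLAR SOCKET AT ANY DATUM CLASS `ΛbP` THAT IS READ INSIDE `Ω₀`** —
`B9SupplySockB9P3ZdBeta.sockB9P3D4β_at` re-proved VERBATIM with the averaging datum class an explicit PARAMETER `ΛbP` (binder `AvgAtγ … ΛbP`, socket
`SockB9P3D4β … ΛbP`) instead of the member's law field `i.Λb`, under the locality law `SeesDom L m (i.Ω 0) ΛbP` (which replaces the internal use of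
`ZdIdx.hbox`; the hypothesis `m ≤ i.k` of the β form is therefore not needed); same constants B₀′ = max{1, 2B₀max{1,q}}, B_∂ = (20d+2)B₀′,
cP = min{1∕16, c₆∕M, a₀∕(K₆M), a₃∕(K₆M), 1∕(2B₀c₆₉K₆M+1)} (B8 p. 86 «Theorem 3.3 of [4] implies the bounds (1.59)», on E(Ω₀), with the Δ′-transfer and the
collar bookkeeping).  At `ΛbP :=` print's class [B6] (2.3) ∕ (1.31) (inner AND crossing bonds — at the cube member `B8Ineq159FlatCubeMemberPrinted.cubeLamBP`,
law by `seesDom_cubeLamBP`) this is EDITION γ of the junction's member supplier.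
[cite: Balaban1985RegularSpaces, (1.58)–(1.59) p.86, (1.31) p.82, Prop. 3 p.87, p.77; Balaban1985BackgroundPropagators, Thm 3.3 p.399, (3.26)–(3.27) p.395, (3.47) p.398, (3.69) p.404; Balaban1984PropagatorsII, (2.3) p.224] -/
theorem sockB9P3D4γ_at (hd2 : 2 ≤ d) (hL : 1 ≤ L) {c35 c₆ K₆ a₃ c69 q : ℝ}
    {M : ℝ} (hM1 : 1 ≤ M) (i : ZdIdx d L) (hMi : Margin2 i.Ω) {m : ℕ}
    (hdict : DictAt geo bg GA L mem ιCfg ιLoc ops M i m) (hP6 : Prop6At bg L mem ιCfg c35 c₆ K₆ M i m)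
    (hinv : InvAt bg L mem ιCfg ops c35 a₃ M i m) (hcurv : CurvAt bg L mem ιCfg ops c35 a₃ c69 M i m)
    (hlan : LandauAt bg L mem ιCfg ops c35 a₃ M i m)
    (ΛbP : ℕ → ℕ → Set (Site d × Fin d)) (havg : AvgAtγ L ops q ΛbP M i m) (hsee : SeesDom L m (i.Ω 0) ΛbP)
    (hK₆ : 0 < K₆) (hc69 : 0 ≤ c69) (hq : 0 ≤ q)
    {B₀ δ₀ a₀ : ℝ} (hB₀ : 0 < B₀)
    (h33U : ∀ (α₀ : ℝ) (U₀ : Site d → Fin d → 𝔸ˣ) (hU₀ : ∀ x κ, U₀ x κ ∈ unitaryUnits 𝔸), 0 < α₀ → M * α₀ ≤ a₀ →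
      (bg (mem M i m)).Reg335 c35 α₀ (ιCfg M i m U₀ hU₀) →
      B9.Ineq342_346_347 (GA (mem M i m)) B₀ δ₀ (ιCfg M i m U₀ hU₀)) :
    SockB9P3D4β (𝔸 := 𝔸) L (max 1 (2 * B₀ * max 1 q)) ((20 * d + 2) * max 1 (2 * B₀ * max 1 q))
      (min (1 / 16) (min (c₆ / M) (min (a₀ / (K₆ * M)) (min (a₃ / (K₆ * M)) (1 / (2 * B₀ * c69 * K₆ * M + 1))))))
      i.η m i.Ω i.Λs ΛbP := by
  intro α₀ α₂ hα₀ hα₀c hα₂ hα₂c U₀ W hU₀ hWu hInA _ hLanW A' _ h41 hA0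
  -- the thresholds
  have hη : 0 < i.η := i.hη
  have hLr : (1 : ℝ) ≤ L := by exact_mod_cast hL
  have hd1 : (1 : ℝ) ≤ d := by exact_mod_cast (le_trans (by norm_num) hd2 : 1 ≤ d)
  have hM0 : 0 < M := lt_of_lt_of_le one_pos hM1
  have hKM : 0 < K₆ * M := mul_pos hK₆ hM0
  simp only [le_min_iff] at hα₀c hα₂c
  obtain ⟨-, hα₀c6, hα₀a0, hα₀a3, hα₀θ⟩ := hα₀c
  obtain ⟨hα₂16, -, -, -, -⟩ := hα₂c
  have hc6 : M * α₀ ≤ c₆ := by rw [mul_comm]; exact (le_div_iff₀ hM0).1 hα₀c6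
  have ha₉0 : 0 < K₆ * α₀ := mul_pos hK₆ hα₀
  have ha0' : M * (K₆ * α₀) ≤ a₀ := by
    have h := (le_div_iff₀ hKM).1 hα₀a0
    calc M * (K₆ * α₀) = α₀ * (K₆ * M) := by ring
      _ ≤ a₀ := h
  have ha3' : M * (K₆ * α₀) ≤ a₃ := by
    have h := (le_div_iff₀ hKM).1 hα₀a3
    calc M * (K₆ * α₀) = α₀ * (K₆ * M) := by ring
      _ ≤ a₃ := h
  have hκ' : 0 ≤ c69 * M * (K₆ * α₀) := by positivity
  have hθ : B₀ * (c69 * M * (K₆ * α₀)) ≤ 1 / 2 := by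
    have hpos : 0 < 2 * B₀ * c69 * K₆ * M + 1 := by positivity
    have h1 : α₀ * (2 * B₀ * c69 * K₆ * M + 1) ≤ 1 := (le_div_iff₀ hpos).1 hα₀θ
    linarith [hα₀.le]
  -- (3.35) for U₀ by Proposition 6, and Theorem 3.3's (3.42)–(3.47) block for G(U₀)
  have hreg : (bg (mem M i m)).Reg335 c35 (K₆ * α₀) (ιCfg M i m U₀ hU₀) := hP6 α₀ U₀ hU₀ hα₀ hc6 hInA
  have h347 := h33U (K₆ * α₀) U₀ hU₀ ha₉0 ha0' hreg
  obtain ⟨-, hd⟩ := hdict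
  have hU₀1 : ∀ x κ, U₀ x κ ∈ U1 𝔸 := fun x κ => unitaryUnits_le_U1 (hU₀ x κ)
  -- the datum and its restriction to the Ω₀-bonds
  have hAglob : ∀ (y : Site d) (τ : Fin d), ‖A' y τ‖ ≤ α₂ * i.η⁻¹ := by
    intro y τ
    by_cases hmem : ∃ j, j ≤ m ∧ SideTouches (i.Ω j) y τ
    · obtain ⟨j, hj, hs⟩ := hmem
      have hLj : (1 : ℝ) ≤ (L : ℝ) ^ j := one_le_pow₀ hLr
      calc ‖A' y τ‖ ≤ α₂ * ((L : ℝ) ^ j * i.η)⁻¹ := (h41 j hj y τ hs).2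
        _ = α₂ * i.η⁻¹ * ((L : ℝ) ^ j)⁻¹ := by rw [mul_inv]; ring
        _ ≤ α₂ * i.η⁻¹ * 1 := by
            apply mul_le_mul_of_nonneg_left (inv_le_one_of_one_le₀ hLj) (by positivity)
        _ = α₂ * i.η⁻¹ := mul_one _
    · rw [hA0 y τ fun j hj hs => hmem ⟨j, hj, hs⟩, norm_zero]
      positivity
  have hAbd : Bdd L m i.η (-(1 : ℝ)) (fun j (b : Site d × Fin d) => SideTouches (i.Ω j) b.1 b.2) (fun b => A' b.1 b.2) := by
    have e1 : (-(1 : ℝ)) = -((1 : ℕ) : ℝ) := by norm_num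
    rw [e1]
    refine B8ScaledSupNorm.bdd_of_forall (c := α₂) fun j hj b hb => ?_
    rw [B8ScaledSupNorm.weight_neg_natCast, pow_one]
    have h := (h41 j hj b.1 b.2 hb).2
    have hs : 0 < (L : ℝ) ^ j * i.η := B8ScaledSupNorm.scale_pos hL hη j
    calc (L : ℝ) ^ j * i.η * ‖A' b.1 b.2‖ ≤ (L : ℝ) ^ j * i.η * (α₂ * ((L : ℝ) ^ j * i.η)⁻¹) :=
          mul_le_mul_of_nonneg_left h hs.le
      _ = α₂ := by rw [mul_comm α₂, ← mul_assoc, mul_inv_cancel₀ hs.ne', one_mul]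
  obtain ⟨Ain, hAin_def⟩ : ∃ Ain : Site d → Fin d → 𝔸, Ain = restrictDom (i.Ω 0) A' := ⟨_, rfl⟩
  have h41b : ∀ j, j ≤ m → ∀ (y : Site d) (τ : Fin d), SideTouches (i.Ω j) y τ → ‖A' y τ‖ ≤ α₂ * ((L : ℝ) ^ j * i.η)⁻¹ :=
    fun j hj y τ hs => (h41 j hj y τ hs).2
  have hOn : OnDom L m i.η i.Ω Ain := by
    rw [hAin_def]; exact B9SupplySockB9P3ZdLettersOmega.onDom_restrictDom hL hη h41b
  have hAin_glob : ∀ (y : Site d) (τ : Fin d), ‖Ain y τ‖ ≤ α₂ * i.η⁻¹ := fun y τ => by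
    rw [hAin_def]; exact (B9SupplySockB9P3ZdLettersOmega.norm_restrictDom_le _ A' y τ).trans (hAglob y τ)
  obtain ⟨a, ha_def⟩ : ∃ a : ℝ,
      a = msup L m i.η (-(1 : ℝ)) (fun j (b : Site d × Fin d) => SideTouches (i.Ω j) b.1 b.2) (fun b => Ain b.1 b.2) := ⟨_, rfl⟩
  have ha0 : 0 ≤ a := by rw [ha_def]; exact B8ScaledSupNorm.msup_nonneg L m hη.le _ _ _
  -- the collar functional Φ₀ and the pointwise control of the outer part
  obtain ⟨Φ, hΦ_def⟩ : ∃ Φ : ℝ, Φ = msup L m i.η (-(1 : ℝ))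
      (fun j (b : Site d × Fin d) => j = 0 ∧ SideTouches (i.Ω 0) b.1 b.2 ∧ ¬ BondTouches (i.Ω 0) b.1 b.2) (fun b => A' b.1 b.2) := ⟨_, rfl⟩
  have hΦ0 : 0 ≤ Φ := by rw [hΦ_def]; exact B8ScaledSupNorm.msup_nonneg L m hη.le _ _ _
  have hbdΦ : Bdd L m i.η (-(1 : ℝ))
      (fun j (b : Site d × Fin d) => j = 0 ∧ SideTouches (i.Ω 0) b.1 b.2 ∧ ¬ BondTouches (i.Ω 0) b.1 b.2) (fun b => A' b.1 b.2) := by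
    have e1 : (-(1 : ℝ)) = -((1 : ℕ) : ℝ) := by norm_num
    rw [e1]
    exact B9SupplySockB9P3ZdLettersOmega.bdd_neg_of_pointwise hL hη 1 fun b => hAglob b.1 b.2
  have hout : ∀ (y : Site d) (τ : Fin d), ‖outerPart (i.Ω 0) A' y τ‖ ≤ i.η⁻¹ * Φ := by
    intro y τ; rw [hΦ_def]
    exact B9SupplySockB9P3ZdLettersOmega.norm_outerPart_le_phi hη hMi hA0 hbdΦ y τ
  -- the Landau condition for A′, hence for 𝟙_{Ω₀}A′; the source J̃ = Δ_a(U₀)𝟙_{Ω₀}A′ and 𝟙_{Ω₀}A′ = G(U₀)J̃ ((1.58))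
  have hLanA : IsLandau138 L m i.η (i.Ω 0) (i.Λs m) U₀ A' :=
    B9SupplySockB9P3Zd.landau_of_landauW hd2 hη U₀ hWu hα₂16 h41 hLanW
  have hLanAin : IsLandau138 L m i.η (i.Ω 0) (i.Λs m) U₀ Ain := by
    rw [hAin_def]; exact (B9SupplySockB9P3ZdLettersOmega.isLandau138_restrictDom_iff L m i.η (i.Ω 0) (i.Λs m) U₀ A').2 hLanA
  obtain ⟨Jt, hJt_def⟩ : ∃ Jt : Site d → Fin d → 𝔸, Jt = deltaAOf i.η (ops M i m) U₀ Ain := ⟨_, rfl⟩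
  have hGJ : (ops M i m).Gop U₀ Jt = Ain :=
    hinv (K₆ * α₀) U₀ hU₀ ha₉0 ha3' hreg Ain hOn Jt fun y τ _ => by rw [hJt_def]
  have hDRD : ∀ (x : Site d) (μ : Fin d), (ops M i m).DRDs U₀ Ain x μ = 0 :=
    hlan (K₆ * α₀) U₀ hU₀ ha₉0 ha3' hreg Ain hOn hLanAin
  have hJtb : ∀ (x : Site d) (μ : Fin d),
      Jt x μ = Jcur i.η U₀ Ain μ x + (ops M i m).Dp U₀ Ain x μ + (ops M i m).DRDs U₀ Ain x μ + (ops M i m).QQ U₀ Ain x μ := by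
    intro x μ; rw [hJt_def]; rfl
  -- the right-hand side quantities: |J|₍₋₃₎ of the datum, |J(𝟙_{Ω₀}A′)|₍₋₃₎, |B₁|
  obtain ⟨nJ, hnJ_def⟩ : ∃ nJ : ℝ, nJ = bondNorm L m i.η (-(3 : ℝ)) i.Ω (fun x μ => Jcur i.η U₀ A' μ x) := ⟨_, rfl⟩
  obtain ⟨nJi, hnJi_def⟩ : ∃ nJi : ℝ, nJi = bondNorm L m i.η (-(3 : ℝ)) i.Ω (fun x μ => Jcur i.η U₀ Ain μ x) := ⟨_, rfl⟩
  obtain ⟨nB, hnB_def⟩ : ∃ nB : ℝ, nB = wsup 1 (fun p : {p : ℕ × (Site d × Fin d) // p.1 ≤ m ∧ (p.2 ∈ ΛbP m p.1 ∨ (p.1 = 0 ∧ CrossB (i.Ω 0) p.2))} =>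
      linCovIter L U₀ (iEta i.η A') p.1.1 p.1.2.1 p.1.2.2) := ⟨_, rfl⟩
  have hnJ0 : 0 ≤ nJ := by rw [hnJ_def]; exact B8ScaledSupNorm.msup_nonneg L m hη.le _ _ _
  have hnB0 : 0 ≤ nB := by rw [hnB_def]; exact B8Eq155JBound.wsup_nonneg zero_le_one _
  have hnB_eq : wsup 1 (fun p : {p : ℕ × (Site d × Fin d) // p.1 ≤ m ∧ (p.2 ∈ ΛbP m p.1 ∨ (p.1 = 0 ∧ CrossB (i.Ω 0) p.2))} =>
      linCovIter L U₀ (iEta i.η Ain) p.1.1 p.1.2.1 p.1.2.2) = nB := by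
    rw [hnB_def, hAin_def]
    exact wsupB1γ_restrictDom hL m i.η hsee U₀ A'
  -- |J(𝟙_{Ω₀}A′)|₍₋₃₎ ≤ |J(A′)|₍₋₃₎ + 16dΦ (the outer part sits at level 0)
  have hnJi_le : nJi ≤ nJ + 16 * d * Φ := by
    rw [hnJi_def, hnJ_def, hAin_def]
    exact B9SupplySockB9P3ZdLettersOmega.bondNorm_jcur_restrict_le hL hη hMi hU₀1 hΦ0 hout hAglob
  -- the current of 𝟙_{Ω₀}A′ is bounded
  have hgrad : ∀ (y : Site d) (κ τ : Fin d), ‖covDerivFwd i.η U₀ κ (fun z => Ain z τ) y‖ ≤ i.η⁻¹ * (α₂ * i.η⁻¹ + α₂ * i.η⁻¹) :=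
    fun y κ τ => (B9SupplySockB9P3ZdLettersOmega.norm_covDerivFwd_le hη (hU₀1 _ _) _).trans
      (mul_le_mul_of_nonneg_left (add_le_add (hAin_glob _ _) (hAin_glob _ _)) (inv_nonneg.mpr hη.le))
  have hJbd : Bdd L m i.η (-(3 : ℝ)) (fun j (b : Site d × Fin d) => BondTouches (i.Ω j) b.1 b.2)
      (fun b => Jcur i.η U₀ Ain b.2 b.1) :=
    B9SupplySockB9P3Zd.bdd_neg_three_of_pointwise hL hη fun b => B9SupplySockB9P3Zd.norm_Jcur_le_of_grad hη hU₀1 hgrad b.2 b.1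
  -- |J̃|₍₋₃₎ ≤ |J(𝟙_{Ω₀}A′)|₍₋₃₎ + c₆₉ M α₀ |𝟙_{Ω₀}A′|₍₋₁₎ + q |B₁| (pointwise: (3.26) with (3.69), the Landau condition, (3.16))
  have hJt : bondNorm L m i.η (-(3 : ℝ)) i.Ω Jt ≤ nJi + c69 * M * (K₆ * α₀) * a + q * nB := by
    have e3 : (-(3 : ℝ)) = -((3 : ℕ) : ℝ) := by norm_num
    have hnJi0 : 0 ≤ nJi := by rw [hnJi_def]; exact B8ScaledSupNorm.msup_nonneg L m hη.le _ _ _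
    refine B8ScaledSupNorm.msup_le (by positivity) fun j hj b hb => ?_
    have hw : weight L i.η (-(3 : ℝ)) j = ((L : ℝ) ^ j * i.η) ^ 3 := by
      rw [e3, B8ScaledSupNorm.weight_neg_natCast]
    have hw0 : 0 ≤ ((L : ℝ) ^ j * i.η) ^ 3 := by positivity
    have h1 : weight L i.η (-(3 : ℝ)) j * ‖Jcur i.η U₀ Ain b.2 b.1‖ ≤ nJi := by
      rw [hnJi_def]; exact B8ScaledSupNorm.weight_mul_norm_le_msup hJbd hj hb
    have h2 : ((L : ℝ) ^ j * i.η) ^ 3 * ‖(ops M i m).Dp U₀ Ain b.1 b.2‖ ≤ c69 * M * (K₆ * α₀) * a := by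
      rw [ha_def]; exact hcurv (K₆ * α₀) U₀ hU₀ ha₉0 ha3' hreg Ain hOn j hj b.1 b.2 hb
    have h4 : ((L : ℝ) ^ j * i.η) ^ 3 * ‖(ops M i m).QQ U₀ Ain b.1 b.2‖ ≤ q * nB := by
      rw [← hnB_eq]; exact havg U₀ hU₀ Ain hOn j hj b.1 b.2 hb
    have hsum : ‖Jt b.1 b.2‖ ≤
        ‖Jcur i.η U₀ Ain b.2 b.1‖ + ‖(ops M i m).Dp U₀ Ain b.1 b.2‖ + ‖(ops M i m).QQ U₀ Ain b.1 b.2‖ := by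
      rw [hJtb, hDRD b.1 b.2, add_zero]
      exact norm_add₃_le
    rw [hw] at h1 ⊢
    calc ((L : ℝ) ^ j * i.η) ^ 3 * ‖Jt b.1 b.2‖
        ≤ ((L : ℝ) ^ j * i.η) ^ 3 *
            (‖Jcur i.η U₀ Ain b.2 b.1‖ + ‖(ops M i m).Dp U₀ Ain b.1 b.2‖ + ‖(ops M i m).QQ U₀ Ain b.1 b.2‖) :=
          mul_le_mul_of_nonneg_left hsum hw0
      _ = ((L : ℝ) ^ j * i.η) ^ 3 * ‖Jcur i.η U₀ Ain b.2 b.1‖ + ((L : ℝ) ^ j * i.η) ^ 3 * ‖(ops M i m).Dp U₀ Ain b.1 b.2‖ +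
            ((L : ℝ) ^ j * i.η) ^ 3 * ‖(ops M i m).QQ U₀ Ain b.1 b.2‖ := by ring
      _ ≤ nJi + c69 * M * (K₆ * α₀) * a + q * nB := add_le_add (add_le_add h1 h2) h4
  -- Theorem 3.3's γ = −3 entries at J̃ through the dictionary ((3.47) ⇒ (1.59) for 𝟙_{Ω₀}A′)
  obtain ⟨hw, hG0, hG1, hG3⟩ := hd U₀ hU₀ Jt
  have hline1 : a ≤ B₀ * bondNorm L m i.η (-(3 : ℝ)) i.Ω Jt := by
    have h := B9.glob_at_minus_three (GA (mem M i m)) h347 0 (ιLoc M i m Jt)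
    rw [hG0, hw, hGJ, ← ha_def] at h
    exact h
  have hline2 : msup L m i.η (-(2 : ℝ)) (fun j (t : Fin d × Fin d × Site d) => SideTouches (i.Ω j) t.2.2 t.2.1)
      (fun t => covDerivFwd i.η U₀ t.1 (fun z => Ain z t.2.1) t.2.2) ≤ B₀ * bondNorm L m i.η (-(3 : ℝ)) i.Ω Jt := by
    have h := B9.glob_at_minus_three (GA (mem M i m)) h347 1 (ιLoc M i m Jt)
    rw [hG1, hw, hGJ] at h
    exact h
  have hline4 : bondNorm L m i.η (-(3 : ℝ)) i.Ω (fun x μ => covLap i.η U₀ (fun z => Ain z μ) x) ≤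
      B₀ * bondNorm L m i.η (-(3 : ℝ)) i.Ω Jt := by
    have h := B9.glob_at_minus_three (GA (mem M i m)) h347 3 (ιLoc M i m Jt)
    rw [hG3, hw, hGJ] at h
    exact h
  -- the a-priori (Neumann) step of G-IF-01 for 𝟙_{Ω₀}A′ with the source norm nJ + 16dΦ
  have hN : bondNorm L m i.η (-(3 : ℝ)) i.Ω Jt ≤ (nJ + 16 * d * Φ) + c69 * M * (K₆ * α₀) * a + q * nB := by
    linarith only [hJt, hnJi_le]
  have hnJ1 : 0 ≤ nJ + 16 * d * Φ := by positivity
  obtain ⟨hA1, hA2, -, hA4, -⟩ := B9SupplySockB9P3Zd.apriori_arith (h := 0) (Cβ := 0) hB₀ hq hκ' hθ ha0 hnJ1 hnB0 le_rfl rfl hN hline1 hline2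
    hline4 (by rw [zero_mul])
  -- bookkeeping constants
  obtain ⟨B', hB'_def⟩ : ∃ B' : ℝ, B' = max 1 (2 * B₀ * max 1 q) := ⟨_, rfl⟩
  have hB'1 : 1 ≤ B' := by rw [hB'_def]; exact le_max_left _ _
  rw [← hB'_def] at hA1 hA2 hA4 ⊢
  -- the four lines for A′ = 𝟙_{Ω₀}A′ + outer part
  have hL1 : msup L m i.η (-(1 : ℝ)) (fun j (b : Site d × Fin d) => SideTouches (i.Ω j) b.1 b.2) (fun b => A' b.1 b.2) ≤ a + Φ := by
    rw [ha_def, hAin_def]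
    exact B9SupplySockB9P3ZdLettersOmega.msup_side_le_restrict_add hη hMi hΦ0 hout hAbd
  have hL2 : msup L m i.η (-(2 : ℝ)) (fun j (t : Fin d × Fin d × Site d) => SideTouches (i.Ω j) t.2.2 t.2.1)
      (fun t => covDerivFwd i.η U₀ t.1 (fun z => A' z t.2.1) t.2.2) ≤
      msup L m i.η (-(2 : ℝ)) (fun j (t : Fin d × Fin d × Site d) => SideTouches (i.Ω j) t.2.2 t.2.1)
        (fun t => covDerivFwd i.η U₀ t.1 (fun z => Ain z t.2.1) t.2.2) + 2 * Φ := by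
    rw [hAin_def]
    exact B9SupplySockB9P3ZdLettersOmega.msup_grad_le_restrict_add hL hη hMi hU₀1 hΦ0 hout hAglob
  have hL4 : bondNorm L m i.η (-(3 : ℝ)) i.Ω (fun x μ => covLap i.η U₀ (fun z => A' z μ) x) ≤
      bondNorm L m i.η (-(3 : ℝ)) i.Ω (fun x μ => covLap i.η U₀ (fun z => Ain z μ) x) + 4 * d * Φ := by
    rw [hAin_def]
    exact B9SupplySockB9P3ZdLettersOmega.bondNorm_covLap_le_restrict_add hL hη hMi hU₀1 hΦ0 hout hAglob
  have hJJ : bondNorm L m i.η (-(3 : ℝ)) i.Ω (fun x μ => pdiv i.η U₀ (plaqCovDeriv i.η U₀ A') μ x) = nJ := by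
    rw [hnJ_def]; rfl
  -- name the remaining large terms, so that the final arithmetic runs on atoms
  obtain ⟨l1, hl1_def⟩ : ∃ l1 : ℝ,
      l1 = msup L m i.η (-(1 : ℝ)) (fun j (b : Site d × Fin d) => SideTouches (i.Ω j) b.1 b.2) (fun b => A' b.1 b.2) := ⟨_, rfl⟩
  obtain ⟨l2, hl2_def⟩ : ∃ l2 : ℝ, l2 = msup L m i.η (-(2 : ℝ)) (fun j (t : Fin d × Fin d × Site d) => SideTouches (i.Ω j) t.2.2 t.2.1)
      (fun t => covDerivFwd i.η U₀ t.1 (fun z => A' z t.2.1) t.2.2) := ⟨_, rfl⟩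
  obtain ⟨g2, hg2_def⟩ : ∃ g2 : ℝ, g2 = msup L m i.η (-(2 : ℝ)) (fun j (t : Fin d × Fin d × Site d) => SideTouches (i.Ω j) t.2.2 t.2.1)
      (fun t => covDerivFwd i.η U₀ t.1 (fun z => Ain z t.2.1) t.2.2) := ⟨_, rfl⟩
  obtain ⟨l4, hl4_def⟩ : ∃ l4 : ℝ, l4 = bondNorm L m i.η (-(3 : ℝ)) i.Ω (fun x μ => covLap i.η U₀ (fun z => A' z μ) x) := ⟨_, rfl⟩
  obtain ⟨g4, hg4_def⟩ : ∃ g4 : ℝ, g4 = bondNorm L m i.η (-(3 : ℝ)) i.Ω (fun x μ => covLap i.η U₀ (fun z => Ain z μ) x) := ⟨_, rfl⟩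
  rw [← hl1_def] at hL1
  rw [← hl2_def, ← hg2_def] at hL2
  rw [← hg2_def] at hA2
  rw [← hl4_def, ← hg4_def] at hL4
  rw [← hg4_def] at hA4
  rw [← hnJ_def, ← hnB_def, ← hΦ_def, hJJ, ← hl1_def, ← hl2_def, ← hl4_def]
  have hd4 : (1 : ℝ) ≤ 4 * d + 2 := by linarith only [hd1]
  refine ⟨?_, ?_, ?_, ?_⟩
  · exact collar_arith (e := 1) hB'1 hΦ0 hd4 (by linarith only [hL1, hA1])
  · exact collar_arith (e := 2) hB'1 hΦ0 (by linarith only [hd1]) (by linarith only [hL2, hA2])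
  · refine collar_arith (e := 0) hB'1 hΦ0 (by linarith only [hd1]) ?_
    have h1 : nJ ≤ B' * nJ := le_mul_of_one_le_left hnJ0 hB'1
    have h2 : 0 ≤ B' * (16 * d * Φ + nB) := by positivity
    calc nJ ≤ B' * nJ := h1
      _ ≤ B' * nJ + B' * (16 * d * Φ + nB) := le_add_of_nonneg_right h2
      _ = B' * (nJ + 16 * d * Φ + nB) + 0 * Φ := by ring
  · exact collar_arith (e := 4 * d) hB'1 hΦ0 (by linarith only [hd1]) (by linarith only [hL4, hA4])


/-- ★ **THEOREM 3.3 (BY NAME) SUPPLIES THE β COLLAR SOCKET AT EVERY MEMBER OF AN INDEX MAP WITH `Margin2`, EVERY TRUNCATION LEVEL `m ≤ k`, AT A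
MEMBER-WISE DATUM CLASS `ΛbP j` READ INSIDE `Ω₀`** (edition γ of `B9SupplySockB9P3ZdBeta.sockB9P3D4β_allLevels_of_thm33_on`: binder `AvgAtγ … (ΛbP j)`,
law `SeesDom` at the levels `m ≤ k`, socket `SockB9P3D4β … (ΛbP j)`; at `ΛbP j :=` print's class this is the edition-γ family supplier). [cite: Balaban1985RegularSpaces, (1.58)–(1.59) p.86, Thm 4 p.88, p.77; Balaban1985BackgroundPropagators, Thm 3.3 p.399, (3.27) p.395] -/
theorem sockB9P3D4γ_allLevels_of_thm33_on (hd2 : 2 ≤ d) (hL : 1 ≤ L) {c35 c₆ K₆ M₃ a₃ c69 q : ℝ}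
    {Gp : ∀ i, B9.KernelFamily (geo i) (bg i)} (h33 : B9.Thm33Printed c35 geo bg Gp GA)
    {J : Type*} (ι : J → ZdIdx d L) (hMJ : ∀ j, Margin2 (ι j).Ω)
    (hdict : ∀ (M : ℝ) (j : J) (m : ℕ), DictAt geo bg GA L mem ιCfg ιLoc ops M (ι j) m)
    (hP6 : ∀ (M : ℝ) (j : J) (m : ℕ), M₃ ≤ M → Prop6At bg L mem ιCfg c35 c₆ K₆ M (ι j) m)
    (hinv : ∀ (M : ℝ) (j : J) (m : ℕ), M₃ ≤ M → InvAt bg L mem ιCfg ops c35 a₃ M (ι j) m)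
    (hcurv : ∀ (M : ℝ) (j : J) (m : ℕ), M₃ ≤ M → CurvAt bg L mem ιCfg ops c35 a₃ c69 M (ι j) m)
    (hlan : ∀ (M : ℝ) (j : J) (m : ℕ), M₃ ≤ M → LandauAt bg L mem ιCfg ops c35 a₃ M (ι j) m)
    (ΛbP : J → ℕ → ℕ → Set (Site d × Fin d)) (havg : ∀ (M : ℝ) (j : J) (m : ℕ), AvgAtγ L ops q (ΛbP j) M (ι j) m)
    (hsee : ∀ (j : J) (m : ℕ), m ≤ (ι j).k → SeesDom L m ((ι j).Ω 0) (ΛbP j))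
    (hc₆ : 0 < c₆) (hK₆ : 0 < K₆) (ha₃ : 0 < a₃) (hc69 : 0 ≤ c69) (hq : 0 ≤ q) :
    ∃ B₀ cP : ℝ, 0 < B₀ ∧ 0 < cP ∧
      ∀ (j : J) (m : ℕ), m ≤ (ι j).k →
        SockB9P3D4β (𝔸 := 𝔸) L (max 1 (2 * B₀ * max 1 q)) ((20 * d + 2) * max 1 (2 * B₀ * max 1 q)) cP
          (ι j).η m (ι j).Ω (ι j).Λs (ΛbP j) := by
  obtain ⟨M₁, δ₀, a₀, B₀, Bβ, Bε, Bεβ, -, -, ha₀, hB₀, H⟩ := h33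
  obtain ⟨M, hM_def⟩ : ∃ M : ℝ, M = max 1 (max M₁ M₃) := ⟨_, rfl⟩
  have hM1 : 1 ≤ M := by rw [hM_def]; exact le_max_left _ _
  have hMM₁ : M₁ ≤ M := by rw [hM_def]; exact (le_max_left _ _).trans (le_max_right _ _)
  have hMM₃ : M₃ ≤ M := by rw [hM_def]; exact (le_max_right _ _).trans (le_max_right _ _)
  have hM0 : 0 < M := lt_of_lt_of_le one_pos hM1
  have hKM : 0 < K₆ * M := mul_pos hK₆ hM0
  refine ⟨B₀, min (1 / 16) (min (c₆ / M) (min (a₀ / (K₆ * M)) (min (a₃ / (K₆ * M)) (1 / (2 * B₀ * c69 * K₆ * M + 1))))),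
    hB₀, ?_, fun j m hm => ?_⟩
  · refine lt_min (by norm_num) (lt_min (div_pos hc₆ hM0) (lt_min (div_pos ha₀ hKM) (lt_min (div_pos ha₃ hKM) ?_)))
    have : 0 < 2 * B₀ * c69 * K₆ * M + 1 := by positivity
    positivity
  · refine sockB9P3D4γ_at geo bg GA L mem ιCfg ιLoc ops hd2 hL hM1 (ι j) (hMJ j) (hdict M j m) (hP6 M j m hMM₃) (hinv M j m hMM₃)
      (hcurv M j m hMM₃) (hlan M j m hMM₃) (ΛbP j) (havg M j m) (hsee j m hm) hK₆ hc69 hq (δ₀ := δ₀) hB₀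
      fun α₀ U₀ hU₀ hα₀ hMa hreg => ?_
    have hMi : M₁ ≤ (geo (mem M (ι j) m)).M := by rw [(hdict M j m).1]; exact hMM₁
    have hMa' : (geo (mem M (ι j) m)).M * α₀ ≤ a₀ := by rw [(hdict M j m).1]; exact hMa
    exact (H (mem M (ι j) m) hMi α₀ hα₀ hMa' (ιCfg M (ι j) m U₀ hU₀) hreg).2.1

/-- ★ **(EXPLICIT CONSTANTS.)  THE β COLLAR SOCKET FAMILY AT A MEMBER-WISE DATUM CLASS FROM THEOREM 3.3's `G(U)`-BLOCK AT NAMED CONSTANTS**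
(edition γ of `B9SupplySockB9P3ZdBeta.sockB9P3D4β_allLevels_explicit_on`). [cite: Balaban1985RegularSpaces, (1.59) p.86, Thm 4 p.88, p.77; Balaban1985BackgroundPropagators, Thm 3.3 p.399] -/
theorem sockB9P3D4γ_allLevels_explicit_on (hd2 : 2 ≤ d) (hL : 1 ≤ L) {c35 c₆ K₆ M₃ a₃ c69 q : ℝ}
    {M₁ δ₀ a₀ B₀ : ℝ} {Bβ Bε : ℝ → ℝ} {Bεβ : ℝ → ℝ → ℝ} (hB₀ : 0 < B₀)
    (H : ∀ i : I, M₁ ≤ (geo i).M → ∀ α₀ : ℝ, 0 < α₀ → (geo i).M * α₀ ≤ a₀ →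
      ∀ U : (bg i).Cfg, (bg i).Reg335 c35 α₀ U →
        B9.Ineq342_346_347 (GA i) B₀ δ₀ U ∧ B9.Ineq343_345 (GA i) Bβ Bε Bεβ δ₀ U)
    {M : ℝ} (hM1 : 1 ≤ M) (hMM₁ : M₁ ≤ M) (hMM₃ : M₃ ≤ M)
    {J : Type*} (ι : J → ZdIdx d L) (hMJ : ∀ j, Margin2 (ι j).Ω)
    (hdict : ∀ (M : ℝ) (j : J) (m : ℕ), DictAt geo bg GA L mem ιCfg ιLoc ops M (ι j) m)
    (hP6 : ∀ (M : ℝ) (j : J) (m : ℕ), M₃ ≤ M → Prop6At bg L mem ιCfg c35 c₆ K₆ M (ι j) m)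
    (hinv : ∀ (M : ℝ) (j : J) (m : ℕ), M₃ ≤ M → InvAt bg L mem ιCfg ops c35 a₃ M (ι j) m)
    (hcurv : ∀ (M : ℝ) (j : J) (m : ℕ), M₃ ≤ M → CurvAt bg L mem ιCfg ops c35 a₃ c69 M (ι j) m)
    (hlan : ∀ (M : ℝ) (j : J) (m : ℕ), M₃ ≤ M → LandauAt bg L mem ιCfg ops c35 a₃ M (ι j) m)
    (ΛbP : J → ℕ → ℕ → Set (Site d × Fin d)) (havg : ∀ (M : ℝ) (j : J) (m : ℕ), AvgAtγ L ops q (ΛbP j) M (ι j) m)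
    (hsee : ∀ (j : J) (m : ℕ), m ≤ (ι j).k → SeesDom L m ((ι j).Ω 0) (ΛbP j))
    (hK₆ : 0 < K₆) (hc69 : 0 ≤ c69) (hq : 0 ≤ q) :
    ∀ (j : J) (m : ℕ), m ≤ (ι j).k →
      SockB9P3D4β (𝔸 := 𝔸) L (max 1 (2 * B₀ * max 1 q)) ((20 * d + 2) * max 1 (2 * B₀ * max 1 q))
        (min (1 / 16) (min (c₆ / M) (min (a₀ / (K₆ * M)) (min (a₃ / (K₆ * M)) (1 / (2 * B₀ * c69 * K₆ * M + 1))))))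
        (ι j).η m (ι j).Ω (ι j).Λs (ΛbP j) := by
  intro j m hm
  refine sockB9P3D4γ_at geo bg GA L mem ιCfg ιLoc ops hd2 hL hM1 (ι j) (hMJ j) (hdict M j m) (hP6 M j m hMM₃) (hinv M j m hMM₃)
    (hcurv M j m hMM₃) (hlan M j m hMM₃) (ΛbP j) (havg M j m) (hsee j m hm) hK₆ hc69 hq (δ₀ := δ₀) hB₀
    fun α₀ U₀ hU₀ hα₀ hMa hreg => ?_
  have hMi : M₁ ≤ (geo (mem M (ι j) m)).M := by rw [(hdict M j m).1]; exact hMM₁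
  have hMa' : (geo (mem M (ι j) m)).M * α₀ ≤ a₀ := by rw [(hdict M j m).1]; exact hMa
  exact (H (mem M (ι j) m) hMi α₀ hα₀ hMa' (ιCfg M (ι j) m U₀ hU₀) hreg).1


end Supply

/-! ## §4 The law at print's class of the cube member of (1.131) (dag-n05-c's `cubeLamBP`, lemmas by name) -/

section Cube

/-- ★ **PRINT'S CLASS AT THE CUBE MEMBER OBEYS `SeesDom` RELATIVE TO `□₀`** (`L ≥ 1`, `L ≤ ρ`, truncation `m ≤ k`): at level `j ≥ 1` the box of every bond of
`cubeLamBP … m j` lies in `□_{j−1} ⊆ □₀` (`B8Ineq159FlatCubeMemberPrinted.cubeLamBP_box_subset_pred`, `B8Eq131Cubes.cube_anti`), at level `0` every bond of the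
class touches `□₀` (`cubeLamBP_zero_bondTouches`). [cite: Balaban1985RegularSpaces, (1.31) p.82, (1.131) p.99, p.98, p.77; Balaban1984PropagatorsII, (2.3) p.224] -/
theorem seesDom_cubeLamBP {L : ℕ} (hL : 1 ≤ L) (a : Site d) (Mc : ℕ) {ρ : ℕ} (hρ : L ≤ ρ) {k m : ℕ} (hmk : m ≤ k) :
    SeesDom L m (cubeFam false L a Mc ρ k 0) (cubeLamBP L a Mc ρ k) := by
  intro j hj c hc
  rcases Nat.eq_zero_or_pos j with rfl | hj1
  · refine Or.inr ⟨rfl, ?_⟩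
    rw [cubeFam_false_zero]
    exact cubeLamBP_zero_bondTouches L a Mc ρ k m hc
  · refine Or.inl fun x hx => ?_
    rw [cubeFam_false_zero]
    exact cube_anti (Nat.zero_le (j - 1)) (by omega) (cubeLamBP_box_subset_pred hL a Mc hρ hj1 hmk hc x hx)

/-- **At truncation `0` every `□₀`-bond belongs to print's class** `cubeLamBP … 0 0` (an end-point in `□₀^{(0)} = □₀`; nothing is excluded at the truncation
level). [cite: Balaban1984PropagatorsII, (2.3) p.224; Balaban1985RegularSpaces, p.77, (1.131) p.99] -/
theorem mem_cubeLamBP_zero_of_bondTouches (L : ℕ) (a : Site d) (Mc ρ k : ℕ) {b : Site d × Fin d}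
    (hb : BondTouches (cube L a Mc ρ k 0) b.1 b.2) : b ∈ cubeLamBP L a Mc ρ k 0 0 := by
  have hsq : ∀ x, x ∈ cube L a Mc ρ k 0 → InBox (sqLo L a ρ k 0) (sqHi L a Mc ρ k 0) x := fun x hx => by
    simpa [cube, B8Ineq130.tlo_zero, B8Ineq130.thi_zero] using hx
  refine ⟨le_rfl, ?_, fun h => absurd h (lt_irrefl 0)⟩
  rcases hb with h | h
  · exact Or.inl (hsq _ h)
  · exact Or.inr (hsq _ h)

/-- **THE SPLIT PRINT CLASS OF THE CUBE MEMBER** (dag-n05-e's `ΛbP′`, CONSUMER-REQS-γ (R1) + the request of 2026-08-27T22:23Z): print's class `cubeLamBP` at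
the levels `j ≥ 1` (inner AND crossing bonds, box law «box ⊂ □_{j−1}»), and at level `0` the INNER level-0 bonds `cubeLamB … m 0` only — the level-0 crossing
bonds of `□₀` being carried by the socket's ∕ binder's own `CrossB (Ω 0)` disjunct (edition β), so that the datum SET is that of `cubeLamBP` while the driver's
box ∕ class laws hold on the class verbatim. [cite: Balaban1984PropagatorsII, (2.3) p.224; Balaban1985RegularSpaces, (1.31) p.82, (1.131) p.99, p.77] -/
def cubeLamBP' (L : ℕ) (a : Site d) (Mc ρ k m j : ℕ) : Set (Site d × Fin d) :=
  if j = 0 then cubeLamB L a Mc ρ k m 0 else cubeLamBP L a Mc ρ k m j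

/-- Level `0` of the split class is the inner class `cubeLamB … m 0`. [cite: Balaban1985RegularSpaces, (1.31) p.82] -/
theorem cubeLamBP'_zero (L : ℕ) (a : Site d) (Mc ρ k m : ℕ) : cubeLamBP' L a Mc ρ k m 0 = cubeLamB L a Mc ρ k m 0 := if_pos rfl

/-- Levels `j ≠ 0` of the split class are print's class `cubeLamBP … m j`. [cite: Balaban1984PropagatorsII, (2.3) p.224] -/
theorem cubeLamBP'_of_ne_zero (L : ℕ) (a : Site d) (Mc ρ k m : ℕ) {j : ℕ} (hj : j ≠ 0) :
    cubeLamBP' L a Mc ρ k m j = cubeLamBP L a Mc ρ k m j := if_neg hj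

/-- ★ **THE SPLIT CLASS OBEYS `SeesDom` RELATIVE TO `□₀`** (`L ≥ 1`, `L ≤ ρ`, `m ≤ k`): at level `0` by `cubeLamB`'s own box law «box ⊂ □₀», at the levels
`j ≥ 1` as `seesDom_cubeLamBP`. [cite: Balaban1985RegularSpaces, (1.31) p.82, (1.131) p.99, p.98; Balaban1984PropagatorsII, (2.3) p.224] -/
theorem seesDom_cubeLamBP' {L : ℕ} (hL : 1 ≤ L) (a : Site d) (Mc : ℕ) {ρ : ℕ} (hρ : L ≤ ρ) {k m : ℕ} (hmk : m ≤ k) :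
    SeesDom L m (cubeFam false L a Mc ρ k 0) (cubeLamBP' L a Mc ρ k) := by
  intro j hj c hc
  rcases Nat.eq_zero_or_pos j with rfl | hj1
  · rw [cubeLamBP'_zero] at hc
    exact Or.inl hc.1
  · rw [cubeLamBP'_of_ne_zero L a Mc ρ k m (Nat.pos_iff_ne_zero.mp hj1)] at hc
    exact seesDom_cubeLamBP hL a Mc hρ hmk j hj c hc

/-- At truncation `0` every INNER `□₀`-bond belongs to the split class (`B9SupplySockB9P3ZdBeta.Witness.cube_inner_mem_lamB0`). [cite: Balaban1985RegularSpaces, (1.31) p.82, (1.131) p.99] -/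
theorem mem_cubeLamBP'_zero_of_inner (L : ℕ) (a : Site d) (Mc ρ k : ℕ) {b : Site d × Fin d}
    (h1 : b.1 ∈ cube L a Mc ρ k 0) (h2 : b.1 + e b.2 ∈ cube L a Mc ρ k 0) : b ∈ cubeLamBP' L a Mc ρ k 0 0 := by
  rw [cubeLamBP'_zero]
  exact B9SupplySockB9P3ZdBeta.Witness.cube_inner_mem_lamB0 h1 h2

/-- At truncation `0` every bond of the split class touches `□₀` (its box lies in `□₀` and contains `c₋`). [cite: Balaban1985RegularSpaces, (1.31) p.82, p.77] -/
theorem cubeLamBP'_zero_bondTouches {L : ℕ} (hL : 1 ≤ L) (a : Site d) (Mc ρ k : ℕ) {b : Site d × Fin d}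
    (hb : b ∈ cubeLamBP' L a Mc ρ k 0 0) : BondTouches (cube L a Mc ρ k 0) b.1 b.2 := by
  rw [cubeLamBP'_zero] at hb
  refine Or.inl ?_
  rw [← cubeFam_false_zero]
  exact hb.1 b.1 (by simpa using B8CubeMemberZd.smul_mem_bondBox hL 0 b.1 b.2)

end Cube

/-! ## §5 A6 WITNESS — the hypothesis set of `sockB9P3D4γ_at` IS INHABITED at (a cube member, truncation `m = 0`) for every admissible class -/

namespace Witness

open B8CubeMemberZd (cubeLamS cubeLamB cubeLamS_self)
open B9SupplySockB9P3ZdBeta.Witness (TB finite_TB_of_box massA opsW opsW_Gop geoW bgW GAW globW glob_bounds fp_unique phi_restr_of_eq extd_restr)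

section Main

variable {𝔸₀ : Type} [CStarAlgebra 𝔸₀] [Nontrivial 𝔸₀]
variable {L : ℕ}

/-- ★★ **A6 WITNESS, EDITION γ: THE HYPOTHESIS SET OF `sockB9P3D4γ_at` IS INHABITED AT EVERY CUBE MEMBER OF (1.131), TRUNCATION `m = 0`, FOR EVERY
DATUM CLASS `ΛbP` WHOSE LEVEL-`0` SET AT TRUNCATION `0` CONTAINS EVERY INNER `□₀`-BOND AND CONSISTS OF `□₀`-BONDS** (the crossing bonds of `□₀` ride in the
binder's own level-0 disjunct) (`d ≥ 2`, `L ≥ 1`, `ρ ≥ 2`; any C⋆-algebra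
`𝔸₀ : Type`): there are a frame, member maps, letters and constants (`M = 1`, `K₆ = c₆ = a₃ = a₀ = B₀ = 1`, `c₆₉ = 0`, `q = aη²`) with `DictAt ∧ Prop6At ∧ InvAt ∧
CurvAt ∧ LandauAt ∧ AvgAtγ … ΛbP` at `(1, i, 0)`, `Margin2`, `SeesDom L 0 (i.Ω 0) ΛbP`, and Theorem 3.3's (3.42)∕(3.46)∕(3.47) block for every unitary `U₀` — the
witness letters and frame are `B9SupplySockB9P3ZdBeta.Witness.opsW ∕ geoW ∕ bgW ∕ GAW` (trivial massive regime) BY IMPORT, unchanged; NO hypothesis on the law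
field `i.Λb` any more (compare `B9SupplySockB9P3ZdBeta.Witness.binders_inhabited_cube_zero`, which needed `i.Λb = cubeLamB …`).  Print's class at the cube
member qualifies (`binders_inhabited_cubeLamBP_zero` below). [cite: Balaban1985BackgroundPropagators, Thm 3.3 p.399, (3.26)–(3.27) p.395, (3.47) p.398, (3.16) p.393; Balaban1985RegularSpaces, (1.58)–(1.59) p.86, (1.31) p.82, (1.131) p.99, p.77; Balaban1984PropagatorsII, (2.3) p.224] -/
theorem binders_inhabited_cube_zero_γ (hd2 : 2 ≤ d) (i : ZdIdx d L) {a : Site d} {Mc ρ : ℕ} (hρ : 2 ≤ ρ)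
    (hΩ : i.Ω = cubeFam false L a Mc ρ i.k) (ΛbP : ℕ → ℕ → Set (Site d × Fin d))
    (hcls : ∀ b : Site d × Fin d, b.1 ∈ i.Ω 0 → b.1 + e b.2 ∈ i.Ω 0 → b ∈ ΛbP 0 0)
    (hseeP : ∀ b ∈ ΛbP 0 0, BondTouches (i.Ω 0) b.1 b.2) :
    ∃ (I : Type) (geo : I → B9.Geometry) (bg : I → B9.Backgrounds) (GA : ∀ x, B9.KernelFamily (geo x) (bg x))
      (mem : ℝ → ZdIdx d L → ℕ → I)
      (ιCfg : ∀ (M : ℝ) (i' : ZdIdx d L) (m : ℕ) (U₀ : Site d → Fin d → 𝔸₀ˣ), (∀ x κ, U₀ x κ ∈ unitaryUnits 𝔸₀) → (bg (mem M i' m)).Cfg)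
      (ιLoc : ∀ (M : ℝ) (i' : ZdIdx d L) (m : ℕ), (Site d → Fin d → 𝔸₀) → (geo (mem M i' m)).Loc)
      (ops : ℝ → ZdIdx d L → ℕ → OpsZd d 𝔸₀) (c35 c₆ K₆ a₃ c69 q B₀ δ₀ a₀ : ℝ),
      0 < K₆ ∧ 0 ≤ c69 ∧ 0 ≤ q ∧ 0 < B₀ ∧ 0 < c₆ ∧ 0 < a₃ ∧ 0 < a₀ ∧ Margin2 i.Ω ∧ SeesDom L 0 (i.Ω 0) ΛbP ∧
      DictAt geo bg GA L mem ιCfg ιLoc ops 1 i 0 ∧ Prop6At bg L mem ιCfg c35 c₆ K₆ 1 i 0 ∧ InvAt bg L mem ιCfg ops c35 a₃ 1 i 0 ∧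
      CurvAt bg L mem ιCfg ops c35 a₃ c69 1 i 0 ∧ LandauAt bg L mem ιCfg ops c35 a₃ 1 i 0 ∧ AvgAtγ L ops q ΛbP 1 i 0 ∧
      (∀ (α₀ : ℝ) (U₀ : Site d → Fin d → 𝔸₀ˣ) (hU₀ : ∀ x κ, U₀ x κ ∈ unitaryUnits 𝔸₀), 0 < α₀ → 1 * α₀ ≤ a₀ →
        (bg (mem 1 i 0)).Reg335 c35 α₀ (ιCfg 1 i 0 U₀ hU₀) → B9.Ineq342_346_347 (GA (mem 1 i 0)) B₀ δ₀ (ιCfg 1 i 0 U₀ hU₀)) := by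
  classical
  have hd : 1 ≤ d := le_trans one_le_two hd2
  have hη : 0 < i.η := i.hη
  have hdpos : (0 : ℝ) < d := by exact_mod_cast hd
  have ha : 0 < massA d i.η := by unfold massA; positivity
  have hΩ0 : i.Ω 0 = {x | InBox (sqLo L a ρ i.k 0) (sqHi L a Mc ρ i.k 0) x} := by
    rw [hΩ, cubeFam_false_zero]; ext x; simp [cube]
  haveI : Fintype (TB (i.Ω 0)) := by
    have hfin := finite_TB_of_box (d := d) (sqLo L a ρ i.k 0) (sqHi L a Mc ρ i.k 0)
    rw [← hΩ0] at hfin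
    exact hfin.fintype
  refine ⟨Unit, fun _ => geoW i, fun _ => bgW d 𝔸₀, fun _ => GAW i hd, fun _ _ _ => (), fun _ _ _ U₀ _ => U₀, fun _ _ _ J => J,
    fun _ _ _ => opsW (i.Ω 0) hd i.η i.hη, 0, 1, 1, 1, 0, massA d i.η * i.η ^ 2, 1, 0, 1,
    one_pos, le_rfl, by positivity, one_pos, one_pos, one_pos, one_pos, ?_, seesDom_zero_of_touch hseeP, ?_, ?_, ?_, ?_, ?_, ?_, ?_⟩
  · rw [hΩ]; exact B9SupplySockB9P3ZdLettersOmega.margin2_cubeFam L a Mc hρ i.k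
  · -- the norm dictionary: by construction of the frame
    refine ⟨rfl, fun U₀ hU₀ J => ⟨?_, ?_, ?_, ?_⟩⟩
    · simp [geoW]
    · simp [GAW, globW]
    · simp [GAW, globW]
    · simp [GAW, globW]
  · -- Proposition 6's class: `Reg335 := ⊤`
    intro _ _ _ _ _ _; trivial
  · -- (3.27): G(U₀) is a left inverse of Δ_a(U₀) = D*_{U₀}D_{U₀} + a on E(Ω₀)
    intro α₀ U₀ hU₀ _ _ _ A hA J hJ
    have hJ' : ∀ (y : Site d) (τ : Fin d), BondTouches (i.Ω 0) y τ →
        J y τ = Jcur i.η U₀ A τ y + (massA d i.η : ℂ) • A y τ := by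
      intro y τ hb
      rw [hJ y τ hb]
      simp [deltaAOf, opsW]
    have hfix := fp_unique (i.Ω 0) hd hη hU₀ J (phi_restr_of_eq (i.Ω 0) hη hd U₀ hA.1 hJ')
    show (opsW (i.Ω 0) hd i.η i.hη).Gop U₀ J = A
    rw [opsW_Gop (i.Ω 0) hd hη hU₀, ← hfix, extd_restr (i.Ω 0) hA.1]
  · -- (3.69): `Δ′ := 0`
    intro α₀ U₀ hU₀ hα₀ _ _ A _ j _ x μ _
    show ((L : ℝ) ^ j * i.η) ^ 3 * ‖(0 : 𝔸₀)‖ ≤ 0 * 1 * α₀ * _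
    simp
  · -- the Landau letter: `DRD* := 0`
    intro _ _ _ _ _ _ _ _ _ _ _; rfl
  · -- (3.16) in the β currency: `Q*aQ := a·1`, `q := aη²`; every Ω₀-bond is a level-0 constraint bond or a crossing bond
    intro U₀ hU₀ A hA j hj x μ hb
    obtain rfl : j = 0 := Nat.le_zero.mp hj
    show ((L : ℝ) ^ 0 * i.η) ^ 3 * ‖(massA d i.η : ℂ) • A x μ‖ ≤ _
    obtain ⟨c, hc⟩ := hA.2
    have e1 : (-(1 : ℝ)) = -((1 : ℕ) : ℝ) := by norm_num
    have hw1 : weight L i.η (-(1 : ℝ)) 0 = i.η := by rw [e1, B8ScaledSupNorm.weight_neg_natCast, pow_zero, one_mul, pow_one]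
    have hside : ∀ (y : Site d) (τ : Fin d), BondTouches (i.Ω 0) y τ → SideTouches (i.Ω 0) y τ := fun y τ h => by
      obtain ⟨κ, hκ⟩ := B9SupplySockB9P3ZdSocketBoundaryMode.exists_ne_fin hd2 τ
      exact B8Eq140Level.sideTouches_of_bondTouches hκ h
    have hnormA : ∀ (y : Site d) (τ : Fin d), BondTouches (i.Ω 0) y τ → i.η * ‖A y τ‖ ≤ c := fun y τ h => by
      have := hc 0 le_rfl (y, τ) (hside y τ h); rwa [hw1] at this
    have hbd : ∀ p : {p : ℕ × (Site d × Fin d) // p.1 ≤ 0 ∧ (p.2 ∈ ΛbP 0 p.1 ∨ (p.1 = 0 ∧ CrossB (i.Ω 0) p.2))},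
        1 * ‖linCovIter L U₀ (iEta i.η A) p.1.1 p.1.2.1 p.1.2.2‖ ≤ c := by
      rintro ⟨⟨j', b⟩, hj', hb'⟩
      obtain rfl : j' = 0 := Nat.le_zero.mp hj'
      have hbt : BondTouches (i.Ω 0) b.1 b.2 := by
        rcases hb' with hmem | ⟨-, hcr⟩
        · exact hseeP b hmem
        · exact hcr.1
      dsimp only
      rw [one_mul, B7Prop4GeneralLevels.linCovIter_zero, iEta, norm_smul, norm_mul, Complex.norm_I, one_mul, Complex.norm_real,
        Real.norm_of_nonneg hη.le]
      exact hnormA b.1 b.2 hbt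
    have hidx : (x, μ) ∈ ΛbP 0 0 ∨ ((0 : ℕ) = 0 ∧ CrossB (i.Ω 0) (x, μ)) := by
      by_cases hin : x ∈ i.Ω 0 ∧ x + e μ ∈ i.Ω 0
      · exact Or.inl (hcls (x, μ) hin.1 hin.2)
      · exact Or.inr ⟨rfl, hb, hin⟩
    have hle := B8Eq155JBound.le_wsup hbd ⟨(0, (x, μ)), le_rfl, hidx⟩
    dsimp only at hle
    rw [one_mul, B7Prop4GeneralLevels.linCovIter_zero, iEta, norm_smul, norm_mul, Complex.norm_I, one_mul, Complex.norm_real,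
      Real.norm_of_nonneg hη.le] at hle
    rw [pow_zero, one_mul, norm_smul, Complex.norm_real, Real.norm_of_nonneg ha.le]
    calc i.η ^ 3 * (massA d i.η * ‖A x μ‖) = (massA d i.η * i.η ^ 2) * (i.η * ‖A x μ‖) := by ring
      _ ≤ (massA d i.η * i.η ^ 2) * _ := mul_le_mul_of_nonneg_left hle (by positivity)
  · -- Theorem 3.3's (3.42)∕(3.46)∕(3.47) block for G(U₀): local entries vanish, the γ = −3 globals by `glob_bounds`
    intro α₀ U₀ hU₀ _ _ _
    refine ⟨fun n lam y y' _ => by simp [GAW, geoW], fun n lam h y y' _ _ => by simp [GAW, geoW], fun n lam γ _ _ => ?_⟩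
    show (GAW i hd).glob n U₀ lam γ ≤ 1 * (geoW i).wNorm γ lam
    by_cases hγ : γ = -3
    · subst hγ; simp only [GAW, geoW, if_true, one_mul]; exact glob_bounds i hd hη rfl hU₀ lam n
    · simp [GAW, geoW, hγ]

/-- ★ **HENCE THE β COLLAR SOCKET AT THE SUPPLIED CLASS HOLDS AT EVERY CUBE MEMBER AT TRUNCATION `0`** for some `B₀ > 0`, `B_∂ ≥ 0`, `cP > 0` — `sockB9P3D4γ_at`
applied to the A6 witness: the γ member supplier is NOT vacuous there. [cite: Balaban1985RegularSpaces, (1.59) p.86, (1.131) p.99; Balaban1985BackgroundPropagators, Thm 3.3 p.399] -/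
theorem sockB9P3D4γ_at_nonvacuous_cube_zero (hd2 : 2 ≤ d) (hL : 1 ≤ L) (i : ZdIdx d L) {a : Site d} {Mc ρ : ℕ} (hρ : 2 ≤ ρ)
    (hΩ : i.Ω = cubeFam false L a Mc ρ i.k) (ΛbP : ℕ → ℕ → Set (Site d × Fin d))
    (hcls : ∀ b : Site d × Fin d, b.1 ∈ i.Ω 0 → b.1 + e b.2 ∈ i.Ω 0 → b ∈ ΛbP 0 0)
    (hseeP : ∀ b ∈ ΛbP 0 0, BondTouches (i.Ω 0) b.1 b.2) :
    ∃ B₀ Bbd cP : ℝ, 0 < B₀ ∧ 0 ≤ Bbd ∧ 0 < cP ∧ SockB9P3D4β (𝔸 := 𝔸₀) L B₀ Bbd cP i.η 0 i.Ω i.Λs ΛbP := by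
  obtain ⟨I, geo, bg, GA, mem, ιCfg, ιLoc, ops, c35, c₆, K₆, a₃, c69, q, B₀, δ₀, a₀, hK₆, hc69, hq, hB₀, hc₆, ha₃, ha₀, hMi, hsee, hdict, hP6,
    hinv, hcurv, hlan, havg, h33U⟩ := binders_inhabited_cube_zero_γ (𝔸₀ := 𝔸₀) hd2 i hρ hΩ ΛbP hcls hseeP
  refine ⟨_, _, _, ?_, ?_, ?_, sockB9P3D4γ_at geo bg GA L mem ιCfg ιLoc ops hd2 hL le_rfl i hMi hdict hP6 hinv hcurv hlan ΛbP havg hsee hK₆ hc69 hq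
    (δ₀ := δ₀) hB₀ h33U⟩
  · positivity
  · positivity
  · have h1 : 0 < 2 * B₀ * c69 * K₆ * 1 + 1 := by positivity
    simp only [lt_min_iff]
    exact ⟨by norm_num, by positivity, by positivity, by positivity, by positivity⟩

/-- ★ **THE A6 WITNESS AT PRINT'S CLASS OF THE CUBE MEMBER**: `binders_inhabited_cube_zero_γ` at `ΛbP := cubeLamBP L a M ρ k` — at truncation `0` the class IS the set
of `□₀`-bonds (`mem_cubeLamBP_zero_of_bondTouches`, `cubeLamBP_zero_bondTouches`). [cite: Balaban1984PropagatorsII, (2.3) p.224; Balaban1985RegularSpaces, (1.59) p.86, (1.131) p.99; Balaban1985BackgroundPropagators, Thm 3.3 p.399] -/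
theorem binders_inhabited_cubeLamBP_zero (hd2 : 2 ≤ d) (i : ZdIdx d L) {a : Site d} {Mc ρ : ℕ} (hρ : 2 ≤ ρ)
    (hΩ : i.Ω = cubeFam false L a Mc ρ i.k) :
    ∃ (I : Type) (geo : I → B9.Geometry) (bg : I → B9.Backgrounds) (GA : ∀ x, B9.KernelFamily (geo x) (bg x))
      (mem : ℝ → ZdIdx d L → ℕ → I)
      (ιCfg : ∀ (M : ℝ) (i' : ZdIdx d L) (m : ℕ) (U₀ : Site d → Fin d → 𝔸₀ˣ), (∀ x κ, U₀ x κ ∈ unitaryUnits 𝔸₀) → (bg (mem M i' m)).Cfg)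
      (ιLoc : ∀ (M : ℝ) (i' : ZdIdx d L) (m : ℕ), (Site d → Fin d → 𝔸₀) → (geo (mem M i' m)).Loc)
      (ops : ℝ → ZdIdx d L → ℕ → OpsZd d 𝔸₀) (c35 c₆ K₆ a₃ c69 q B₀ δ₀ a₀ : ℝ),
      0 < K₆ ∧ 0 ≤ c69 ∧ 0 ≤ q ∧ 0 < B₀ ∧ 0 < c₆ ∧ 0 < a₃ ∧ 0 < a₀ ∧ Margin2 i.Ω ∧ SeesDom L 0 (i.Ω 0) (cubeLamBP L a Mc ρ i.k) ∧
      DictAt geo bg GA L mem ιCfg ιLoc ops 1 i 0 ∧ Prop6At bg L mem ιCfg c35 c₆ K₆ 1 i 0 ∧ InvAt bg L mem ιCfg ops c35 a₃ 1 i 0 ∧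
      CurvAt bg L mem ιCfg ops c35 a₃ c69 1 i 0 ∧ LandauAt bg L mem ιCfg ops c35 a₃ 1 i 0 ∧ AvgAtγ L ops q (cubeLamBP L a Mc ρ i.k) 1 i 0 ∧
      (∀ (α₀ : ℝ) (U₀ : Site d → Fin d → 𝔸₀ˣ) (hU₀ : ∀ x κ, U₀ x κ ∈ unitaryUnits 𝔸₀), 0 < α₀ → 1 * α₀ ≤ a₀ →
        (bg (mem 1 i 0)).Reg335 c35 α₀ (ιCfg 1 i 0 U₀ hU₀) → B9.Ineq342_346_347 (GA (mem 1 i 0)) B₀ δ₀ (ιCfg 1 i 0 U₀ hU₀)) := by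
  have hΩ0 : i.Ω 0 = cube L a Mc ρ i.k 0 := by rw [hΩ, cubeFam_false_zero]
  exact binders_inhabited_cube_zero_γ hd2 i hρ hΩ _
    (fun b hb _ => mem_cubeLamBP_zero_of_bondTouches L a Mc ρ i.k (by rw [← hΩ0]; exact Or.inl hb))
    (fun b hb => by rw [hΩ0]; exact cubeLamBP_zero_bondTouches L a Mc ρ i.k 0 hb)

/-- ★ **HENCE THE β COLLAR SOCKET AT PRINT'S CLASS HOLDS AT EVERY CUBE MEMBER AT TRUNCATION `0`** for some `B₀ > 0`, `B_∂ ≥ 0`, `cP > 0` (`L ≥ 1`): the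
edition-γ member supplier at `cubeLamBP` is NOT vacuous there (the `m ≥ 1` levels are the located content, dag-n05-c `B8Ineq159FlatShellModeCrossingDatum`).
[cite: Balaban1985RegularSpaces, (1.59) p.86, (1.131) p.99; Balaban1984PropagatorsII, (2.3) p.224; Balaban1985BackgroundPropagators, Thm 3.3 p.399] -/
theorem sockB9P3D4γ_at_nonvacuous_cubeLamBP_zero (hd2 : 2 ≤ d) (hL : 1 ≤ L) (i : ZdIdx d L) {a : Site d} {Mc ρ : ℕ} (hρ : 2 ≤ ρ)
    (hΩ : i.Ω = cubeFam false L a Mc ρ i.k) :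
    ∃ B₀ Bbd cP : ℝ, 0 < B₀ ∧ 0 ≤ Bbd ∧ 0 < cP ∧ SockB9P3D4β (𝔸 := 𝔸₀) L B₀ Bbd cP i.η 0 i.Ω i.Λs (cubeLamBP L a Mc ρ i.k) := by
  have hΩ0 : i.Ω 0 = cube L a Mc ρ i.k 0 := by rw [hΩ, cubeFam_false_zero]
  exact sockB9P3D4γ_at_nonvacuous_cube_zero hd2 hL i hρ hΩ _
    (fun b hb _ => mem_cubeLamBP_zero_of_bondTouches L a Mc ρ i.k (by rw [← hΩ0]; exact Or.inl hb))
    (fun b hb => by rw [hΩ0]; exact cubeLamBP_zero_bondTouches L a Mc ρ i.k 0 hb)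

/-- ★ **THE A6 WITNESS AT THE SPLIT CLASS `cubeLamBP'` OF THE CUBE MEMBER** (dag-n05-e's `ΛbP′`): `binders_inhabited_cube_zero_γ` at `ΛbP := cubeLamBP' L a M ρ k`.
[cite: Balaban1984PropagatorsII, (2.3) p.224; Balaban1985RegularSpaces, (1.59) p.86, (1.131) p.99; Balaban1985BackgroundPropagators, Thm 3.3 p.399] -/
theorem sockB9P3D4γ_at_nonvacuous_cubeLamBP'_zero (hd2 : 2 ≤ d) (hL : 1 ≤ L) (i : ZdIdx d L) {a : Site d} {Mc ρ : ℕ} (hρ : 2 ≤ ρ)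
    (hΩ : i.Ω = cubeFam false L a Mc ρ i.k) :
    ∃ B₀ Bbd cP : ℝ, 0 < B₀ ∧ 0 ≤ Bbd ∧ 0 < cP ∧ SockB9P3D4β (𝔸 := 𝔸₀) L B₀ Bbd cP i.η 0 i.Ω i.Λs (cubeLamBP' L a Mc ρ i.k) := by
  have hΩ0 : i.Ω 0 = cube L a Mc ρ i.k 0 := by rw [hΩ, cubeFam_false_zero]
  exact sockB9P3D4γ_at_nonvacuous_cube_zero hd2 hL i hρ hΩ _
    (fun b h1 h2 => mem_cubeLamBP'_zero_of_inner L a Mc ρ i.k (by rw [← hΩ0]; exact h1) (by rw [← hΩ0]; exact h2))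
    (fun b hb => by rw [hΩ0]; exact cubeLamBP'_zero_bondTouches hL a Mc ρ i.k hb)

end Main

end Witness

end Literature.MathematicalPhysics.QuantumFieldTheory.Balaban1983to89.B9SupplySockB9P3ZdGamma

end
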